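import Summits.HodgeConjecture.HodgeConjecture.Theorems.F0P3cDbTThetaRoadW1                    -- ★ p850793: the (O2θ-W1) ∕ (D) binder currency (theta types, Keys labels, signed packet, transfer)
import Summits.HodgeConjecture.HodgeConjecture.Theorems.F0P3cDbTThetaPairAtLabel                 -- ★ (TPᴸ) `thetaType_pin_at_label`: «πⁿ ∘ e IS a theta type at some line εn» (pin + Keys labels)
import Summits.HodgeConjecture.HodgeConjecture.Theorems.F0P3cDbTSupercuspidalOffOccurringClass    -- ★ (SCᴸ) `u1Disjoint_holds` (‹U1-DISJOINT›); pulls ★ CLS, ★ GLUE «Ne», ★ GR90 Prop. 5.2.2, ★ K1occ, ★ K1aW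
import Summits.HodgeConjecture.HodgeConjecture.Theorems.F0P2oU1DichotomyOfDisjoint               -- ★ `hDich_of_disjoint`: the `(U(1), U(1))` dichotomy in XOR form from ‹U1-DISJOINT›
import Summits.HodgeConjecture.HodgeConjecture.Theorems.F0P2oThetaTypeNotL2                      -- ★ `nonempty_equiv_of_thetaTypeAtCM`: a theta-type class IS `⟦X_v ∘ κ_v⁻¹⟧`
import HarnessLib

/-!
# K2_E2 «WeilCharacterThetaRoad» — socket (D) `StubPiNOtherTowerThetaType` PAID: «`πⁿ(ξ_v) ∘ e` is the theta type of a line INEQUIVALENT to the line of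
# any supercuspidal theta type», BY OCCURRENCE (no Witt-class transport)

Cell `pub/hodgecm-mathlib`, Track B «K2-LIT», ENGINE E2; crux H413 = `stmt-HodgeConjecture-24833` (lane `--supports`), route HCCMUnconditional; seat
`hodgecm-mathlib-K2E2-p12` (g4), DEAL (D) of K2E2-plan (g3) 2026-09-04T05:45:50Z (3).  Target = tier 0 `Cruxes/H413/Lines/K2_E2_WeilCharacterThetaRoad.lean` ED. 2
(2026-09-04T05:56Z) `def StubPiNOtherTowerThetaType` :188–268 (statement bytes = ED. 1 :181–261, frozen) — the statement of `piNOtherTowerThetaType_holds` below IS that body VERBATIM (by value), so the dealer's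
next edition re-points `stub_piNOtherTowerThetaType := K2E2WPiNOtherTowerThetaType.piNOtherTowerThetaType_holds` by one token.  THEOREMS ONLY (no `def`, no instance, no
notation, no named fact, no `sorry`); every input is a ★ theorem of the tree.  HONEST LABEL: HC_CM is proved only modulo the 7 printed citations (2 remaining named inputs:
hLiu418 = stmt-HodgeConjecture-24832, h413 = stmt-HodgeConjecture-24833) until rung 0 closes; this file proves no printed citation by itself and closes no socket until tied.

THE STATEMENT.  Under the (O2θ-W1) binders (CM field `L`, hermitian `H` with unit determinant, transfer data, Rogawski's `μω` with `μω|_{𝕀_{L⁺}} = ω_{L/L⁺}`, a theta frame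
`(e₁, dV, g)`, one-dimensional `ξ = (η, ψ)`, DICT-tied `(μ, χ_f)`, a finite place `v` of `L⁺` NOT split in `L`, a form congruence `ᵗT̄·H_v·T = a·Φ₃`, a Haar measure `μZ` on
`U(Φ₃)(L⁺_v) ⧸ Z` and Keys labels `(π², πⁿ)` of `JH(i_G(χ_ξ))` with `πⁿ` not square-integrable): for every line `ε` and every SUPERCUSPIDAL class `c` of `U(H)(L⁺_v)` which is
the theta type `X_v(μ, ε, χ_f) ∘ κ_v⁻¹` (★ `ThetaTypeAtCM`), there is a line `ε₁` with `ε₁ ε⁻¹ ∉ N(L_wˣ)` such that `πⁿ ∘ e` (★ `IrrClass.comap` along ★ `cmDatumLocalCongr`) is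
the theta type at `ε₁`.  PRINT: `πⁿ(ξ_v) = ω(γ_v, ψ_v, χ_v)` and `πˢ(ξ_v) = ω(γ_v, ψ_v^{ε}, χ_v)` are the lifts of ONE character from the two INEQUIVALENT hermitian lines
[GelbartRogawski1991, (5.1.1) + Lem. 5.1.2 p. 466 «ψ_v ranges over a set of representatives … modulo N_{E/F}(E_v^*)»; §1.4 pp. 450–451]; the `(U(1), U(1))` dichotomy
[HarrisKudlaSweet1996, Cor. 4.4; Rogawski1992, Prop. 3.4]; [GelbartRogawski1990, Prop. 5.2.2] (non-occurrence ⟺ supercuspidal).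

THE ROAD «BY OCCURRENCE» (differs from the `_Sigs` plan D1 + D2 + D4: the Witt-class transport D4 is NOT used).  Let `ψθ` be the theta centre character (one for every line,
★ `F0P2oK1aWOfLetters.exists_forall_isThetaCenterChar`; continuous, ★ `F0P2oK1occ.continuous_of_isThetaCenterChar`) and write `occ(a)` for «`ψθ` occurs in the rank-one Weil
representation `ω¹_a` of the Witt kernel line» (★ `OccursInLineWeilCM`).  [GR90 Prop. 5.2.2] in the tree (★ `F0P2oGR90Prop522OfLetters.GR90Prop522_of_letters` over N3 ★ and
N6 ★): `X_v(μ, a, χ_f)` is supercuspidal ⟺ `¬ occ(a)`.  The dichotomy in XOR form (★ `F0P2oU1DichotomyOfDisjoint.hDich_of_disjoint` at ★ ‹U1-DISJOINT›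
`F0P3cDbTSupercuspidalOffOccurringClass.u1Disjoint_holds`): for `a₂a₁⁻¹ ∉ N`, `occ(a₁) ∨ occ(a₂)` and `¬(occ(a₁) ∧ occ(a₂))`.
* (§1) `thetaTypeAtCM_unique` — the theta type at a fixed line is ONE class (★ `nonempty_equiv_of_thetaTypeAtCM` twice: both classes are `⟦X_v ∘ κ_v⁻¹⟧`);
  `isSupercuspidal_xThetaCM_of_thetaTypeAtCM` — a SUPERCUSPIDAL theta-type class forces `X_v(μ, ε, χ_f)` supercuspidal (transport back along the equivalence, ★
  `IsSupercuspidal.of_equiv`, and along `κ_v`, ★ `IsSupercuspidal.comp_continuousMulEquiv` + ★ `Representation.comp_coe_symm_comp_coe`).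
* (§2) the closer.  `εn` with `ThetaTypeAtCM … εn v (πⁿ ∘ e)` is ★ `F0P3cDbTThetaPairAtLabel.thetaType_pin_at_label`.  (a) `¬ occ(ε)`: `X_v(ε)` is supercuspidal by §1.
  (b) `occ(εn)`: else `X_v(εn)` is supercuspidal, ★ CLS `stubThetaClassOfSupercuspidal_holds` gives a supercuspidal theta-type class at `εn`, which by §1 IS `πⁿ ∘ e` —
  contradicting ★ GLUE «Ne» `F0P3cStCharTSNe.ne_comap_πn_of_isSupercuspidal` at the Keys labels.  (c) Suppose `εn ε⁻¹ = x x̄`.  Take a global non-norm `θ` at `v` (★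
  `F0P2oK1occ.exists_units_not_isNorm_of_nonsplit`); XOR at `(ε, θε)` gives `occ(θε)`; `(θε) εn⁻¹` is a non-norm (else `θ = (εn ε⁻¹)·((θε) εn⁻¹)` would be the norm of
  `x·y`), so XOR at `(εn, θε)` forbids `occ(εn) ∧ occ(θε)` — contradiction.  Hence `ε₁ := εn` has `ε₁ ε⁻¹ ∉ N`.

## References
* [GelbartRogawski1991] S. Gelbart, J. Rogawski, *L-functions and Fourier–Jacobi coefficients for the unitary group U(3)*, Invent. Math. 105 (1991): §1.4 pp. 450–451;
  §5.1 (5.1.1) p. 465, Lem. 5.1.2 p. 466, Remark p. 466; §5.2 p. 467 L25–27.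
* [GelbartRogawski1990] S. Gelbart, J. Rogawski, *Exceptional representations and Shimura's integral for the local unitary group U(3)*, Israel Math. Conf. Proc. 2 (1990): Prop. 5.2.2.
* [HarrisKudlaSweet1996] M. Harris, S. Kudla, W. J. Sweet, *Theta dichotomy for unitary groups*, J. Amer. Math. Soc. 9 (1996): Cor. 4.4 p. 962; Thm. 6.1 p. 967.
* [Rogawski1990] J. Rogawski, *Automorphic representations of unitary groups in three variables*, Ann. of Math. Stud. 123 (1990): §12.2 (2) pp. 173–174; §13.1 Prop. 13.1.3 (d) p. 199.
* [Rogawski1992] J. Rogawski, *The multiplicity formula for A-packets*, in: The zeta functions of Picard modular surfaces (CRM, 1992): Prop. 3.4.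
* [BushnellHenniart2006] C. Bushnell, G. Henniart, *The local Langlands conjecture for GL(2)*, Grundlehren 335 (2006): §1.1, §10.1 (classes, supercuspidal transport).
-/

set_option autoImplicit false
-- the mandated namespace repeats the single-problem summit's segment (`HodgeConjecture.HodgeConjecture`)
set_option linter.dupNamespace false

noncomputable section

open NumberField IsDedekindDomain MeasureTheory
open scoped Matrix ComplexOrder

namespace Summit.HodgeConjecture.HodgeConjecture.Cruxes.H413.K2E2WPiNOtherTowerThetaType

open Literature.NumberTheory Literature.NumberTheory.Automorphic Literature.NumberTheory.Automorphic.UnitaryGroup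
open Literature.NumberTheory.Automorphic.IdeleClassGroup
open Literature.NumberTheory.Automorphic.Liu2021 Literature.NumberTheory.Automorphic.Liu2021.Def411WeilCarriers
open Literature.NumberTheory.GaloisRepresentations
open Literature.NumberTheory.Rogawski1990 Literature.NumberTheory.GelbartRogawski1991
open Summit.HodgeConjecture.HodgeConjecture.Cruxes.H413

/-! ## §1 Two transport lemmas on the predicate «the class `c` IS the theta type `X_v(μ, ε, χ_f) ∘ κ_v⁻¹`» -/

/-- **Supercuspidality descends along `ρ ↦ ρ ∘ e⁻¹`** (generic; `e : G ≃ₜ* G′` an isomorphism of topological groups): if `ρ ∘ e⁻¹` is supercuspidal then so is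
`ρ = (ρ ∘ e⁻¹) ∘ e` (★ `IsSupercuspidal.comp_continuousMulEquiv`, ★ `Representation.comp_coe_symm_comp_coe`). [cite: BushnellHenniart2006, §10.1] -/
theorem isSupercuspidal_of_comp_coe_symm {G G' : Type} [Group G] [TopologicalSpace G] [SeparatelyContinuousMul G] [Group G'] [TopologicalSpace G']
    [SeparatelyContinuousMul G'] {V : Type*} [AddCommGroup V] [Module ℂ V] (ρ : Representation ℂ G V) (e : G ≃ₜ* G')
    (h : Representation.IsSupercuspidal (ρ.comp (e.symm : G' →* G))) : ρ.IsSupercuspidal := by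
  have h' := h.comp_continuousMulEquiv e
  rwa [Representation.comp_coe_symm_comp_coe] at h'

section Transport

variable (L : Type) [Field L] [NumberField L] [IsCMField L] (H : Matrix (Fin 3) (Fin 3) L) {n' : ℕ} (e₁ : Fin 3 × Fin 1 ≃ Fin n')
    (dV : Fin 3 → L) (hdV : ∀ i, IsCMField.complexConj L (dV i) = dV i) (hdV0 : ∀ i, dV i ≠ 0) (g : GL (Fin 3) L)
    (hg : ((g : Matrix (Fin 3) (Fin 3) L).map (cmConjRingHom L))ᵀ * H * (g : Matrix (Fin 3) (Fin 3) L) = Matrix.diagonal dV)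
    (μ : Literature.NumberTheory.Automorphic.IdeleClassGroup L →ₜ* Circle) (hμ : IsConjugateSymplectic L μ)
    (χf : UnitaryGroup.finAdelicOne (↥(maximalRealSubfield L)) L (IsCMField.complexConj L) →* ℂˣ)
    (hcont : Continuous χf) (hunit : ∀ z, ‖((χf z : ℂˣ) : ℂ)‖ = 1) (ε : (↥(maximalRealSubfield L))ˣ)
    (v : HeightOneSpectrum (𝓞 ↥(maximalRealSubfield L)))

include hcont hunit

set_option synthInstance.maxHeartbeats 400000 in
set_option maxHeartbeats 8000000 in -- MEASURED (as ★ `F0P2oThetaTypeNotL2.nonempty_equiv_of_thetaTypeAtCM`): the `xThetaCM ∘ κ_v⁻¹` abbreviations are heavy to elaborate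
/-- **UNIQUENESS OF THE THETA TYPE AT A FIXED LINE** (the `_Sigs` row D2 `K2E2WThetaTypeUnique`, generic frame): two classes of `U(H)(L⁺_v)` which ARE the theta type
`X_v(μ, ε, χ_f) ∘ κ_v⁻¹` (★ `ThetaTypeAtCM`) coincide — read on `localPi … H v` (★ `localPiEquiv`) any representatives are both equivalent to `πH := X_v ∘ κ_v⁻¹`
(★ `F0P2oThetaTypeNotL2.nonempty_equiv_of_thetaTypeAtCM`; Howe irreducibility of the `χ_{f,v}`-coinvariants is inside it, ★ `isIrreducible_xThetaCM`), hence to each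
other, and ★ `IrrClass.comap` along `localPiEquiv` is injective. [cite: GelbartRogawski1991, §5.1 (5.1.1), Lem. 5.1.2 p. 466] [cite: BushnellHenniart2006, §1.1] -/
theorem thetaTypeAtCM_unique (c c' : IrrClass ((cmDatum L 3 H).Local v))
    (hθ : ThetaTypeAtCM L H e₁ dV hdV hdV0 g hg μ hμ χf ε v c) (hθ' : ThetaTypeAtCM L H e₁ dV hdV hdV0 g hg μ hμ χf ε v c') : c = c' := by
  obtain ⟨r, hr⟩ := IrrClass.mk_surjective (IrrClass.comap (localPiEquiv L (IsCMField.complexConj L) 3 H v) c)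
  obtain ⟨r', hr'⟩ := IrrClass.mk_surjective (IrrClass.comap (localPiEquiv L (IsCMField.complexConj L) 3 H v) c')
  obtain ⟨e⟩ := F0P2oThetaTypeNotL2.nonempty_equiv_of_thetaTypeAtCM L H e₁ dV hdV hdV0 g hg μ hμ χf hcont hunit ε v c hθ r hr
  obtain ⟨e'⟩ := F0P2oThetaTypeNotL2.nonempty_equiv_of_thetaTypeAtCM L H e₁ dV hdV hdV0 g hg μ hμ χf hcont hunit ε v c' hθ' r' hr'
  refine IrrClass.comap_injective (localPiEquiv L (IsCMField.complexConj L) 3 H v) ?_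
  rw [← hr, ← hr']
  exact IrrClass.mk_eq_mk_of_equiv (e.trans e'.symm)

set_option synthInstance.maxHeartbeats 400000 in
set_option maxHeartbeats 8000000 in -- MEASURED (as ★ `F0P2oThetaClassOfSupercuspidal.isSupercuspidal_piH`): the `xThetaCM ∘ κ_v⁻¹` abbreviations are heavy to elaborate
/-- **A SUPERCUSPIDAL THETA-TYPE CLASS FORCES `X_v(μ, ε, χ_f)` SUPERCUSPIDAL** (the converse of ★ CLS `F0P2oThetaClassOfSupercuspidal.stubThetaClassOfSupercuspidal_holds`):
if `c` is supercuspidal and IS the theta type at `ε`, then a representative `r` of `c` read on `localPi … H v` is supercuspidal (★ `IrrClass.IsSupercuspidal.comap`),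
`r ≅ πH = X_v ∘ κ_v⁻¹` (★ `nonempty_equiv_of_thetaTypeAtCM`) transports it (★ `IsSupercuspidal.of_equiv`), and `X_v = πH ∘ κ_v` (`isSupercuspidal_of_comp_coe_symm`).
[cite: BushnellHenniart2006, §10.1] [cite: GelbartRogawski1991, §1.4 p. 451 L1–4] -/
theorem isSupercuspidal_xThetaCM_of_thetaTypeAtCM (c : IrrClass ((cmDatum L 3 H).Local v))
    (hθ : ThetaTypeAtCM L H e₁ dV hdV hdV0 g hg μ hμ χf ε v c) (hsc : c.IsSupercuspidal) :
    (xThetaCM L e₁ dV hdV hdV0 μ hμ χf ε v).IsSupercuspidal := by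
  obtain ⟨r, hr⟩ := IrrClass.mk_surjective (IrrClass.comap (localPiEquiv L (IsCMField.complexConj L) 3 H v) c)
  obtain ⟨e⟩ := F0P2oThetaTypeNotL2.nonempty_equiv_of_thetaTypeAtCM L H e₁ dV hdV hdV0 g hg μ hμ χf hcont hunit ε v c hθ r hr
  have hr_sc : r.ρ.IsSupercuspidal := by
    rw [← IrrClass.isSupercuspidal_mk r, hr]
    exact hsc.comap (localPiEquiv L (IsCMField.complexConj L) 3 H v)
  exact isSupercuspidal_of_comp_coe_symm _ (localCongr L (IsCMField.complexConj L) g one_ne_zero (by rw [one_smul]; exact hg) v) (hr_sc.of_equiv e)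

end Transport

/-! ## §2 The socket (D) of tier 0, BY NAME and BY VALUE -/

open scoped Classical in
set_option synthInstance.maxHeartbeats 400000 in
set_option maxHeartbeats 8000000 in -- MEASURED (as tier 0 `thetaTypeScCompletesW1_of_twoTower`): 80 binder lines of CM abbreviations
/-- **(D) «πⁿ ∘ e IS THE THETA TYPE OF THE OTHER TOWER» — `StubPiNOtherTowerThetaType` of tier 0 `Lines/K2_E2_WeilCharacterThetaRoad.lean` (ED. 2 :188–268 = ED. 1 :181–261), statement
VERBATIM.**  Under the (O2θ-W1) binders: for every line `ε` and every supercuspidal class `c` of `U(H)(L⁺_v)` which is the theta type `X_v(μ, ε, χ_f) ∘ κ_v⁻¹`, there is a line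
`ε₁` with `ε₁ · ε⁻¹` NOT a local norm at `v` such that `πⁿ ∘ e` is the theta type `X_v(μ, ε₁, χ_f) ∘ κ_v⁻¹`.  Witness `ε₁ := εn` of ★ `thetaType_pin_at_label`; the non-norm
clause BY OCCURRENCE (module docstring, road (a)(b)(c)): [GR90 Prop. 5.2.2] ★ + the `(U(1), U(1))` dichotomy in XOR form ★ + a global non-norm ★ + ★ CLS + §1 + ★ GLUE «Ne».
[cite: GelbartRogawski1991, §5.1 (5.1.1), Lem. 5.1.2 p. 466; §1.4 pp. 450–451] [cite: GelbartRogawski1990, Prop. 5.2.2] [cite: HarrisKudlaSweet1996, Cor. 4.4 p. 962; Thm. 6.1 p. 967]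
[cite: Rogawski1990, §12.2 (2) pp. 173–174; §13.1 Prop. 13.1.3 (d) p. 199] [cite: Rogawski1992, Prop. 3.4] -/
theorem piNOtherTowerThetaType_holds :
  ∀ (L : Type) [Field L] [NumberField L] [IsCMField L] (H : Matrix (Fin 3) (Fin 3) L)
    (hH : (H.map (cmConjRingHom L))ᵀ = H) (hHd : IsUnit H.det)
    [∀ v : HeightOneSpectrum (𝓞 ↥(maximalRealSubfield L)), MeasurableSpace ((cmDatum L 3 H).Local v)]
    [∀ v : HeightOneSpectrum (𝓞 ↥(maximalRealSubfield L)),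
      MeasurableSpace ((cmDatum L 2 (Matrix.of fun i j : Fin 2 => if i.val + j.val + 1 = 2 then (1 : L) else 0)).Local v ×
        (cmDatum L 1 (Matrix.of fun i j : Fin 1 => if i.val + j.val + 1 = 1 then (1 : L) else 0)).Local v)]
    [∀ (v : HeightOneSpectrum (𝓞 ↥(maximalRealSubfield L)))
        (a : ((cmDatum L 2 (Matrix.of fun i j : Fin 2 => if i.val + j.val + 1 = 2 then (1 : L) else 0)).Local v ×
          (cmDatum L 1 (Matrix.of fun i j : Fin 1 => if i.val + j.val + 1 = 1 then (1 : L) else 0)).Local v)),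
      MeasurableSpace (((cmDatum L 2 (Matrix.of fun i j : Fin 2 => if i.val + j.val + 1 = 2 then (1 : L) else 0)).Local v ×
          (cmDatum L 1 (Matrix.of fun i j : Fin 1 => if i.val + j.val + 1 = 1 then (1 : L) else 0)).Local v) ⧸
        Subgroup.centralizer ({a} : Set ((cmDatum L 2 (Matrix.of fun i j : Fin 2 => if i.val + j.val + 1 = 2 then (1 : L) else 0)).Local v ×
          (cmDatum L 1 (Matrix.of fun i j : Fin 1 => if i.val + j.val + 1 = 1 then (1 : L) else 0)).Local v)))]
    [∀ (v : HeightOneSpectrum (𝓞 ↥(maximalRealSubfield L))) (γ : (cmDatum L 3 H).Local v),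
      MeasurableSpace ((cmDatum L 3 H).Local v ⧸ Subgroup.centralizer ({γ} : Set ((cmDatum L 3 H).Local v)))]
    (Δ : ∀ v : HeightOneSpectrum (𝓞 ↥(maximalRealSubfield L)), LocalTransferFactor L H v)
    (mH : ∀ v : HeightOneSpectrum (𝓞 ↥(maximalRealSubfield L)),
      OrbitalMeasureFamily ((cmDatum L 2 (Matrix.of fun i j : Fin 2 => if i.val + j.val + 1 = 2 then (1 : L) else 0)).Local v ×
        (cmDatum L 1 (Matrix.of fun i j : Fin 1 => if i.val + j.val + 1 = 1 then (1 : L) else 0)).Local v))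
    (mG : ∀ v : HeightOneSpectrum (𝓞 ↥(maximalRealSubfield L)), OrbitalMeasureFamily ((cmDatum L 3 H).Local v))
    (νG : ∀ v : HeightOneSpectrum (𝓞 ↥(maximalRealSubfield L)), Measure ((cmDatum L 3 H).Local v))
    (νH : ∀ v : HeightOneSpectrum (𝓞 ↥(maximalRealSubfield L)),
      Measure ((cmDatum L 2 (Matrix.of fun i j : Fin 2 => if i.val + j.val + 1 = 2 then (1 : L) else 0)).Local v ×
        (cmDatum L 1 (Matrix.of fun i j : Fin 1 => if i.val + j.val + 1 = 1 then (1 : L) else 0)).Local v))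
    [∀ v : HeightOneSpectrum (𝓞 ↥(maximalRealSubfield L)), BorelSpace ((cmDatum L 3 H).Local v)]
    [∀ v : HeightOneSpectrum (𝓞 ↥(maximalRealSubfield L)),
      BorelSpace ((cmDatum L 2 (Matrix.of fun i j : Fin 2 => if i.val + j.val + 1 = 2 then (1 : L) else 0)).Local v ×
        (cmDatum L 1 (Matrix.of fun i j : Fin 1 => if i.val + j.val + 1 = 1 then (1 : L) else 0)).Local v)]
    [∀ (v : HeightOneSpectrum (𝓞 ↥(maximalRealSubfield L)))
        (a : ((cmDatum L 2 (Matrix.of fun i j : Fin 2 => if i.val + j.val + 1 = 2 then (1 : L) else 0)).Local v ×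
          (cmDatum L 1 (Matrix.of fun i j : Fin 1 => if i.val + j.val + 1 = 1 then (1 : L) else 0)).Local v)),
      BorelSpace (((cmDatum L 2 (Matrix.of fun i j : Fin 2 => if i.val + j.val + 1 = 2 then (1 : L) else 0)).Local v ×
          (cmDatum L 1 (Matrix.of fun i j : Fin 1 => if i.val + j.val + 1 = 1 then (1 : L) else 0)).Local v) ⧸
        Subgroup.centralizer ({a} : Set ((cmDatum L 2 (Matrix.of fun i j : Fin 2 => if i.val + j.val + 1 = 2 then (1 : L) else 0)).Local v ×
          (cmDatum L 1 (Matrix.of fun i j : Fin 1 => if i.val + j.val + 1 = 1 then (1 : L) else 0)).Local v)))]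
    [∀ (v : HeightOneSpectrum (𝓞 ↥(maximalRealSubfield L))) (γ : (cmDatum L 3 H).Local v),
      BorelSpace ((cmDatum L 3 H).Local v ⧸ Subgroup.centralizer ({γ} : Set ((cmDatum L 3 H).Local v)))]
    [∀ v, (νG v).IsHaarMeasure] [∀ v, (νG v).IsMulRightInvariant] [∀ v, (νH v).IsHaarMeasure] [∀ v, (νH v).IsMulRightInvariant],
    ∀ (μω : HeckeCharacter L) (hμu : μω.IsUnitary),
    (∀ x : Literature.NumberTheory.GaloisRepresentations.ideleGroup ↥(maximalRealSubfield L),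
      μω (AdeleRing.ideleBaseChange (↥(maximalRealSubfield L)) L x) = quadraticHeckeCharCM L x) →
    Δ = finExplicitCollection L H μω (finExplicitDelta_conj_left_all L H μω) (finExplicitDelta_conj_right_all L H μω) →
    (∀ v : HeightOneSpectrum (𝓞 ↥(maximalRealSubfield L)), (mH v).IsCanonical (IsLocalGRegular L v) (νH v) ∧
      (mG v).IsCanonical (fun γ => IsRegularElt (γ.val : GL (Fin 3) (UnitaryGroup.LocalRing L v))) (νG v)) →
    CMCharIdentityPackageTestSigned L H hH hHd νH νG μω hμu Δ mH mG →
    (∀ v : HeightOneSpectrum (𝓞 ↥(maximalRealSubfield L)), (∀ w : PlacesOver L v, IsCMField.complexConj L • w.1 = w.1) →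
      IsLocalDeltaTransferExists L H v (Δ v) (mH v) (mG v) Literature.NumberTheory.Rogawski1990.IsLocSmooth
        Literature.NumberTheory.Rogawski1990.IsLocSmooth) →
    ∀ {n' : ℕ} (e₁ : Fin 3 × Fin 1 ≃ Fin n') (dV : Fin 3 → L) (hdV : ∀ i, IsCMField.complexConj L (dV i) = dV i) (hdV0 : ∀ i, dV i ≠ 0)
      (g : GL (Fin 3) L) (hg : ((g : Matrix (Fin 3) (Fin 3) L).map (cmConjRingHom L))ᵀ * H * (g : Matrix (Fin 3) (Fin 3) L) = Matrix.diagonal dV)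
      (ξ : OneDimAutRepH L)
      (μ : Literature.NumberTheory.Automorphic.IdeleClassGroup L →ₜ* Circle) (hμ : IsConjugateSymplectic L μ)
      (χf : UnitaryGroup.finAdelicOne (↥(maximalRealSubfield L)) L (IsCMField.complexConj L) →* ℂˣ),
      Continuous χf → (∀ z, ‖((χf z : ℂˣ) : ℂ)‖ = 1) →
      HasWeight L μ 1 → IsAutomorphicOneChar (↥(maximalRealSubfield L)) L (IsCMField.complexConj L) χf →
      (∀ v : HeightOneSpectrum (𝓞 ↥(maximalRealSubfield L)),
          (toHeckeCharacter L μ).semilocalComponent L v = (ξ.bcη⁻¹ * ξ.bcψ⁻¹ * μω).semilocalComponent L v) →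
      (∀ z : (FiniteAdeleRing (𝓞 L) L)ˣ,
          χf (finAdelicCheck (↥(maximalRealSubfield L)) L (IsCMField.complexConj L)
              (AlgEquiv.ext fun x => by rw [AlgEquiv.mul_apply, IsCMField.complexConj_apply_apply, AlgEquiv.one_apply]) z) =
            (ξ.bcψ⁻¹ * (ξ.bcη⁻¹ * ξ.bcψ⁻¹ * μω) ^ 2)
              (Units.map (N := AdeleRing (𝓞 L) L) (MonoidHom.inr (InfiniteAdeleRing L) (FiniteAdeleRing (𝓞 L) L)) z)) →
      ∀ (v : HeightOneSpectrum (𝓞 ↥(maximalRealSubfield L))), (∀ w : PlacesOver L v, IsCMField.complexConj L • w.1 = w.1) →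
      ∀ (T : GL (Fin 3) (LocalRing L v)) (a : LocalRing L v) (ha : IsUnit a)
        (h : formCongr (conjLocal L (IsCMField.complexConj L) v) T (H.map (algebraMap L (LocalRing L v))) =
          a • (Matrix.of fun i j : Fin 3 => if i.val + j.val + 1 = 3 then (1 : L) else 0).map (algebraMap L (LocalRing L v))),
      ∀ [MeasurableSpace (Gqs L v ⧸ Subgroup.center (Gqs L v))] [BorelSpace (Gqs L v ⧸ Subgroup.center (Gqs L v))]
        (μZ : Measure (Gqs L v ⧸ Subgroup.center (Gqs L v))) [μZ.IsHaarMeasure],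
      ∀ (π2 πn : IrrClass (Gqs L v)),
        KeysCaseTwoLabels L v (μω.semilocalComponent L v) (torusLocalComponent L (IsCMField.complexConj L) v ξ.η)
          (torusLocalComponent L (IsCMField.complexConj L) v ξ.ψ) π2 πn →
        ¬ πn.IsSquareIntegrable μZ →
        -- (D) «for every supercuspidal theta type c of line ε, πⁿ ∘ e is the theta type of a line ε₁ inequivalent to ε»
        ∀ (ε : (↥(maximalRealSubfield L))ˣ) (c : IrrClass ((cmDatum L 3 H).Local v)),
          ThetaTypeAtCM L H e₁ dV hdV hdV0 g hg μ hμ χf ε v c →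
          c.IsSupercuspidal →
          ∃ ε₁ : (↥(maximalRealSubfield L))ˣ,
            ¬ (∃ x : (LocalRing L v)ˣ, (x : LocalRing L v) * conjLocal L (IsCMField.complexConj L) v x =
            algebraMap L (LocalRing L v) (((ε₁ * ε⁻¹ : (↥(maximalRealSubfield L))ˣ) : ↥(maximalRealSubfield L)) : L)) ∧
            ThetaTypeAtCM L H e₁ dV hdV hdV0 g hg μ hμ χf ε₁ v (IrrClass.comap (cmDatumLocalCongr L v T ha h).symm πn) := by
  intro L _ _ _ H hH hHd _ _ _ _ Δ mH mG νG νH _ _ _ _ _ _ _ _ μω hμu hquad hΔ hcan hpack hex n' e₁ dV hdV hdV0 g hg ξ μ hμ χf hcont hunit hw haut hμξ hχξ v hv T a ha h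
    _ _ μZ _ π2 πn hK hn ε c hθ hsc
  -- the line `εn` of `πⁿ ∘ e` (★ pin at the (D-b)ᵀ label)
  obtain ⟨εn, hθn⟩ := F0P3cDbTThetaPairAtLabel.thetaType_pin_at_label L H hH hHd e₁ dV hdV hdV0 g hg ξ μω hμu hquad μ hμ χf hcont hunit hμξ hχξ
    v hv T a ha h μZ π2 πn hK hn
  refine ⟨εn, ?_, hθn⟩
  rintro ⟨x, hx⟩
  -- the theta centre character `ψθ` (one for every line), continuous
  obtain ⟨ψθ, hψθ⟩ := F0P2oK1aWOfLetters.exists_forall_isThetaCenterChar L μ χf v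
  have hψc : Continuous fun β => ((ψθ β : ℂˣ) : ℂ) := F0P2oK1occ.continuous_of_isThetaCenterChar L μ χf hcont 1 v ψθ (hψθ 1)
  -- [GR90 Prop. 5.2.2]: `X_v(μ, a, χ_f)` supercuspidal ⟺ `ψθ` does not occur in `ω¹_a`
  have h522 : ∀ a' : (↥(maximalRealSubfield L))ˣ, (xThetaCM L e₁ dV hdV hdV0 μ hμ χf a' v).IsSupercuspidal ↔
      ¬ OccursInLineWeilCM L (Equiv.prodUnique (Fin 1) (Fin 1)) (kernelLineCM dV) (complexConj_kernelLineCM dV hdV) (kernelLineCM_ne_zero dV hdV0) μ hμ a' v ψθ :=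
    fun a' => F0P2oGR90Prop522OfLetters.GR90Prop522_of_letters F0P2oLineJacquetHolds.thetaType_nonsplit_jacquetModule_holds
      Literature.NumberTheory.Rogawski1990.u3_isSupercuspidal_iff_jacquet_eq_zero_holds L e₁ dV hdV hdV0 (Equiv.prodUnique (Fin 1) (Fin 1)) μ hμ χf hcont hunit
      v hv a' ψθ (hψθ a')
  -- (a) no occurrence at `ε`: `X_v(ε)` is supercuspidal since the supercuspidal `c` is its theta type
  have hnoccε : ¬ OccursInLineWeilCM L (Equiv.prodUnique (Fin 1) (Fin 1)) (kernelLineCM dV) (complexConj_kernelLineCM dV hdV) (kernelLineCM_ne_zero dV hdV0) μ hμ ε v ψθ :=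
    (h522 ε).1 (isSupercuspidal_xThetaCM_of_thetaTypeAtCM L H e₁ dV hdV hdV0 g hg μ hμ χf hcont hunit ε v c hθ hsc)
  -- (b) occurrence at `εn`: `X_v(εn)` is NOT supercuspidal (its theta-type class is `πⁿ ∘ e`, not a supercuspidal class by ★ GLUE «Ne»)
  have hoccn : OccursInLineWeilCM L (Equiv.prodUnique (Fin 1) (Fin 1)) (kernelLineCM dV) (complexConj_kernelLineCM dV hdV) (kernelLineCM_ne_zero dV hdV0) μ hμ εn v ψθ := by
    by_contra hno
    obtain ⟨πs, hπs, hθs⟩ := F0P2oThetaClassOfSupercuspidal.stubThetaClassOfSupercuspidal_holds L H hH hHd e₁ dV hdV hdV0 g hg μ hμ χf hcont hunit v hv εn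
      ((h522 εn).2 hno)
    exact F0P3cStCharTSNe.ne_comap_πn_of_isSupercuspidal L H v hv T a ha h _ _ _ π2 πn hK πs hπs
      (thetaTypeAtCM_unique L H e₁ dV hdV hdV0 g hg μ hμ χf hcont hunit εn v πs _ hθs hθn)
  -- (c) a global non-norm `θ` at `v`, the third line `θ·ε`, and the dichotomy in XOR form
  obtain ⟨θ, hθN⟩ := F0P2oK1occ.exists_units_not_isNorm_of_nonsplit L v hv
  have hD := F0P2oU1DichotomyOfDisjoint.hDich_of_disjoint F0P3cDbTSupercuspidalOffOccurringClass.u1Disjoint_holds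
  -- XOR at `(ε, θ·ε)` (ratio `θ`): `ψθ` occurs at `θ·ε`
  have hratio₁ : ((θ * ε) * ε⁻¹ : (↥(maximalRealSubfield L))ˣ) = θ := mul_inv_cancel_right θ ε
  obtain ⟨hor, -⟩ := hD L (Equiv.prodUnique (Fin 1) (Fin 1)) (kernelLineCM dV) (complexConj_kernelLineCM dV hdV) (kernelLineCM_ne_zero dV hdV0) μ hμ v hv
    ε (θ * ε) (by rw [hratio₁]; exact hθN) ψθ hψc
  have hoccθε := hor.resolve_left hnoccε
  -- `(θ·ε)·εn⁻¹` is a non-norm: otherwise `θ = (εn·ε⁻¹)·((θ·ε)·εn⁻¹)` is the norm of `x·y`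
  have hratio₂ : ((εn * ε⁻¹) * ((θ * ε) * εn⁻¹) : (↥(maximalRealSubfield L))ˣ) = θ := by
    rw [mul_comm (θ * ε) εn⁻¹, mul_mul_mul_comm, mul_inv_cancel, one_mul, mul_comm θ ε, inv_mul_cancel_left]
  have hnn : ¬ ∃ y : (LocalRing L v)ˣ, (y : LocalRing L v) * conjLocal L (IsCMField.complexConj L) v y =
      algebraMap L (LocalRing L v) ((((θ * ε) * εn⁻¹ : (↥(maximalRealSubfield L))ˣ) : ↥(maximalRealSubfield L)) : L) := by
    rintro ⟨y, hy⟩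
    refine hθN ⟨x * y, ?_⟩
    rw [Units.val_mul, map_mul, mul_mul_mul_comm, hx, hy, ← map_mul, ← MulMemClass.coe_mul, ← Units.val_mul, hratio₂]
  -- XOR at `(εn, θ·ε)`: not both occur — contradiction
  obtain ⟨-, hnand⟩ := hD L (Equiv.prodUnique (Fin 1) (Fin 1)) (kernelLineCM dV) (complexConj_kernelLineCM dV hdV) (kernelLineCM_ne_zero dV hdV0) μ hμ v hv
    εn (θ * ε) hnn ψθ hψc
  exact hnand ⟨hoccn, hoccθε⟩

end Summit.HodgeConjecture.HodgeConjecture.Cruxes.H413.K2E2WPiNOtherTowerThetaType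

end
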